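import Summits.Ventures.CertifiedManyBodySolver.Downfold.EmeryBoxesLa214VertexFloorsA
import Summits.Ventures.CertifiedManyBodySolver.Downfold.EmeryBoxesLa214VertexFloorsB
import Summits.Ventures.CertifiedManyBodySolver.Downfold.EmeryBoxesLa214VertexFloorsC
import Summits.Ventures.CertifiedManyBodySolver.Downfold.EmeryBoxesLa214VertexFloorsD
import Summits.Ventures.CertifiedManyBodySolver.Downfold.EmeryBoxesLa214VertexFloorsE
import Summits.Ventures.CertifiedManyBodySolver.Downfold.EmeryBoxesLa214VertexFloorsF
import Summits.Ventures.CertifiedManyBodySolver.Downfold.EmeryBoxesLa214VertexFloorsG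
import Summits.Ventures.CertifiedManyBodySolver.Downfold.EmeryBoxesLa214VertexFloorsH
import Summits.Ventures.CertifiedManyBodySolver.Downfold.EmeryBoxesLa214Planes
import Summits.Ventures.CertifiedManyBodySolver.Downfold.EmeryAffineBandSeam
import Summits.Ventures.CertifiedManyBodySolver.Downfold.EmeryBoxesLa214V123
import HarnessLib

/-!
# La₂CuO₄ (#18) companion `emeryBoxLa214v123`: THE FIRST FUNCTION-VALUED TWO-SIDED THREE-BAND BOX WORD — affine bands
# `A(q) − w ≤ e(q) ≤ A(q)` on the WHOLE five-parameter box, w = 0.593 eV per lattice site (device «KLDL-V», hubbard-box-p2 g16)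

Venture CertifiedManyBodySolver, crew hubbard-fast S2 (iv) «three-band Emery boxes», seat hubbard-box-p2 (g16); namespace `Summit.Ventures.CertifiedManyBodySolver.Downfold`.
WHY (hubbard-box-p3 g20 metrology, pub/hubbard-fast INBOX 2026-08-28T15:45Z): across the La₂CuO₄ companion (U_d from 4.83 to 10.5 eV, Δ from 1.7 to 4 eV, …) the energy
ITSELF ranges by ≥ 1.26 eV/site, so no constant pair can be narrower than ≈ 1.06 — the window of record [1.1752246, 3.9111860] (width 2.736) is mostly range-of-e.
THE FIX: both sides as FUNCTIONS of the parameters. Cap: one KLDL-R Rayleigh plane `A(q) = Σ_k q_k · lineCoeff_k` (valid at every q). Floor: `e − A` is jointly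
concave (`concaveOn_emeryEnergyDensity_line`), so its minimum over the box sits at one of the 32 vertices (`EmeryAffineBandSeam`,
`emeryEnergyDensity_line_mem_affineBand_of_corners`), where the kernel floors of `EmeryBoxesLa214VertexFloorsA…H` bound it: `w = max_v (A(v) − F_v)`.

THE WORDS (ρ = 5/4, cuprate signs, εp = 0; eV per lattice site):
* `emeryBoxLa214v123_cuprate_energyBand_c3hh`: plane `kry_La214_c3hh_s10x10`, line coefficients ≈ (-0.45077, -0.15938, 0.33544, 0.91456, 0.09013, 0.41740), width w = 2963767/5000000 ≈ 0.5927534 (worst vertex `hh_llh`)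
* `emeryBoxLa214v123_cuprate_energyBand_cm`: plane `kry_La214_cm_s10x10`, line coefficients ≈ (-0.43931, -0.14625, 0.32886, 0.92114, 0.08304, 0.42351), width w = 6108557/10000000 ≈ 0.6108557 (worst vertex `hh_llh`)
* `la214BoxCentre_energyWindow`: at the box centre `(t_pd, t_pp, Δ, U_d, U_p) = (281/200, 14/25, 57/20, 1533/200, 119/25)` (no certificate was ever computed there)
  the bands give `2.3183345 ≤ e ≤ 2.8297024` (width 0.5114).
So at EVERY point of the box the three-band energy is now certified to ±0.30 eV/site around an explicit affine function — 4.6× sharper than the constant pair,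
with zero new cap vectors (the planes are g15's) and 28 five-orbital kernel certificates (kit j313186, 0.04 core-h; 112 files `decide +kernel`).

HONEST FRAMING: CERTIFIED inequalities (kernel, std axioms, 0 sorry) on a SCREENING-GRADE object (box ends [float] literature/DFT, locators in
`router/BOXES/La2CuO4-family.md`); energy words of the decorated three-band model only — no phase sentence, nothing about superconductivity, no router number moves;
INFL-3to1 stays screening-grade. WHAT-THIS-IS-NOT: a statement at other fillings (doped LSCO needs the N = 19/21 planes and filling convexity — same device, next file).
-/

noncomputable section

namespace Summit.Ventures.CertifiedManyBodySolver.Downfold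

open NonemptyInterval Matrix Finset Literature.Probability.LatticeModels
open Literature.MathematicalPhysics.QuantumLattice Literature.Computation.Certificates ClusterLowerBound
open Summit.Ventures.CertifiedManyBodySolver.Certificates
open scoped BigOperators ComplexOrder

/-! ## §1 The bands -/

/-- **Affine band of plane `La214_c3hh` as an S2 statement on the delivered six-box** (usable at any explicit point `q` of the box): width `2963767/5000000` ≈ 0.5927534
eV/site, the worst vertex slack (vertex `hh_llh`). [cite: Rockafellar1970, Thm 32.2] [cite: Ruelle1969, §3.3] -/
theorem la214Band_c3hh_line {q : Fin 6 → ℝ}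
    (hq : q ∈ Set.Icc (![129/100, 23/50, 17/10, 0, 483/100, 339/100] : Fin 6 → ℝ) ![38/25, 33/50, 4, 0, 21/2, 613/100]) :
    ∑ k, q k * lineCoeff cuprateSigns (fun a => (kry_La214_c3hh_s10x10_S a : ℝ) / 1099509064370 / 16) k - (2963767/5000000 : ℝ) ≤ emeryEnergyDensity (emeryLine cuprateSigns q) (5 / 4) ∧
      emeryEnergyDensity (emeryLine cuprateSigns q) (5 / 4) ≤ ∑ k, q k * lineCoeff cuprateSigns (fun a => (kry_La214_c3hh_s10x10_S a : ℝ) / 1099509064370 / 16) k := by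
  refine emeryEnergyDensity_line_mem_affineBand_of_corners cuprateSigns la214Plane_c3hh_capTheta _ _ ?_ hq
  intro a ha b hb c hc d hd e he f hf
  simp only [Finset.mem_insert, Finset.mem_singleton, Matrix.cons_val_zero, Matrix.cons_val_one, Matrix.cons_val_two,
    Matrix.cons_val, Matrix.head_cons, Matrix.tail_cons] at ha hb hc hd he hf
  rcases ha with rfl | rfl <;> rcases hb with rfl | rfl <;> rcases hc with rfl | rfl <;> rcases hd with rfl | rfl <;>
    rcases he with rfl | rfl <;> rcases hf with rfl | rfl
  · exact le_trans (by rw [la214Plane_c3hh_lineCoeff]; norm_num [Fin.sum_univ_succ]) la214V_ll_lll_floor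
  · exact le_trans (by rw [la214Plane_c3hh_lineCoeff]; norm_num [Fin.sum_univ_succ]) la214V_ll_llh_floor
  · exact le_trans (by rw [la214Plane_c3hh_lineCoeff]; norm_num [Fin.sum_univ_succ]) la214V_ll_lhl_floor
  · exact le_trans (by rw [la214Plane_c3hh_lineCoeff]; norm_num [Fin.sum_univ_succ]) la214V_ll_lhh_floor
  · exact le_trans (by rw [la214Plane_c3hh_lineCoeff]; norm_num [Fin.sum_univ_succ]) la214V_ll_lll_floor
  · exact le_trans (by rw [la214Plane_c3hh_lineCoeff]; norm_num [Fin.sum_univ_succ]) la214V_ll_llh_floor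
  · exact le_trans (by rw [la214Plane_c3hh_lineCoeff]; norm_num [Fin.sum_univ_succ]) la214V_ll_lhl_floor
  · exact le_trans (by rw [la214Plane_c3hh_lineCoeff]; norm_num [Fin.sum_univ_succ]) la214V_ll_lhh_floor
  · exact le_trans (by rw [la214Plane_c3hh_lineCoeff]; norm_num [Fin.sum_univ_succ]) la214V_ll_hll_floor
  · exact le_trans (by rw [la214Plane_c3hh_lineCoeff]; norm_num [Fin.sum_univ_succ]) la214V_ll_hlh_floor
  · exact le_trans (by rw [la214Plane_c3hh_lineCoeff]; norm_num [Fin.sum_univ_succ]) la214V_ll_hhl_floor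
  · exact le_trans (by rw [la214Plane_c3hh_lineCoeff]; norm_num [Fin.sum_univ_succ]) la214V_ll_hhh_floor
  · exact le_trans (by rw [la214Plane_c3hh_lineCoeff]; norm_num [Fin.sum_univ_succ]) la214V_ll_hll_floor
  · exact le_trans (by rw [la214Plane_c3hh_lineCoeff]; norm_num [Fin.sum_univ_succ]) la214V_ll_hlh_floor
  · exact le_trans (by rw [la214Plane_c3hh_lineCoeff]; norm_num [Fin.sum_univ_succ]) la214V_ll_hhl_floor
  · exact le_trans (by rw [la214Plane_c3hh_lineCoeff]; norm_num [Fin.sum_univ_succ]) la214V_ll_hhh_floor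
  · exact le_trans (by rw [la214Plane_c3hh_lineCoeff]; norm_num [Fin.sum_univ_succ]) la214V_lh_lll_floor
  · exact le_trans (by rw [la214Plane_c3hh_lineCoeff]; norm_num [Fin.sum_univ_succ]) la214V_lh_llh_floor
  · exact le_trans (by rw [la214Plane_c3hh_lineCoeff]; norm_num [Fin.sum_univ_succ]) la214V_lh_lhl_floor
  · exact le_trans (by rw [la214Plane_c3hh_lineCoeff]; norm_num [Fin.sum_univ_succ]) la214V_lh_lhh_floor
  · exact le_trans (by rw [la214Plane_c3hh_lineCoeff]; norm_num [Fin.sum_univ_succ]) la214V_lh_lll_floor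
  · exact le_trans (by rw [la214Plane_c3hh_lineCoeff]; norm_num [Fin.sum_univ_succ]) la214V_lh_llh_floor
  · exact le_trans (by rw [la214Plane_c3hh_lineCoeff]; norm_num [Fin.sum_univ_succ]) la214V_lh_lhl_floor
  · exact le_trans (by rw [la214Plane_c3hh_lineCoeff]; norm_num [Fin.sum_univ_succ]) la214V_lh_lhh_floor
  · exact le_trans (by rw [la214Plane_c3hh_lineCoeff]; norm_num [Fin.sum_univ_succ]) la214V_lh_hll_floor
  · exact le_trans (by rw [la214Plane_c3hh_lineCoeff]; norm_num [Fin.sum_univ_succ]) la214V_lh_hlh_floor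
  · exact le_trans (by rw [la214Plane_c3hh_lineCoeff]; norm_num [Fin.sum_univ_succ]) la214V_lh_hhl_floor
  · exact le_trans (by rw [la214Plane_c3hh_lineCoeff]; norm_num [Fin.sum_univ_succ]) la214V_lh_hhh_floor
  · exact le_trans (by rw [la214Plane_c3hh_lineCoeff]; norm_num [Fin.sum_univ_succ]) la214V_lh_hll_floor
  · exact le_trans (by rw [la214Plane_c3hh_lineCoeff]; norm_num [Fin.sum_univ_succ]) la214V_lh_hlh_floor
  · exact le_trans (by rw [la214Plane_c3hh_lineCoeff]; norm_num [Fin.sum_univ_succ]) la214V_lh_hhl_floor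
  · exact le_trans (by rw [la214Plane_c3hh_lineCoeff]; norm_num [Fin.sum_univ_succ]) la214V_lh_hhh_floor
  · exact le_trans (by rw [la214Plane_c3hh_lineCoeff]; norm_num [Fin.sum_univ_succ]) la214V_hl_lll_floor
  · exact le_trans (by rw [la214Plane_c3hh_lineCoeff]; norm_num [Fin.sum_univ_succ]) la214V_hl_llh_floor
  · exact le_trans (by rw [la214Plane_c3hh_lineCoeff]; norm_num [Fin.sum_univ_succ]) la214V_hl_lhl_floor
  · exact le_trans (by rw [la214Plane_c3hh_lineCoeff]; norm_num [Fin.sum_univ_succ]) la214V_hl_lhh_floor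
  · exact le_trans (by rw [la214Plane_c3hh_lineCoeff]; norm_num [Fin.sum_univ_succ]) la214V_hl_lll_floor
  · exact le_trans (by rw [la214Plane_c3hh_lineCoeff]; norm_num [Fin.sum_univ_succ]) la214V_hl_llh_floor
  · exact le_trans (by rw [la214Plane_c3hh_lineCoeff]; norm_num [Fin.sum_univ_succ]) la214V_hl_lhl_floor
  · exact le_trans (by rw [la214Plane_c3hh_lineCoeff]; norm_num [Fin.sum_univ_succ]) la214V_hl_lhh_floor
  · exact le_trans (by rw [la214Plane_c3hh_lineCoeff]; norm_num [Fin.sum_univ_succ]) la214V_hl_hll_floor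
  · exact le_trans (by rw [la214Plane_c3hh_lineCoeff]; norm_num [Fin.sum_univ_succ]) la214V_hl_hlh_floor
  · exact le_trans (by rw [la214Plane_c3hh_lineCoeff]; norm_num [Fin.sum_univ_succ]) la214V_hl_hhl_floor
  · exact le_trans (by rw [la214Plane_c3hh_lineCoeff]; norm_num [Fin.sum_univ_succ]) la214V_hl_hhh_floor
  · exact le_trans (by rw [la214Plane_c3hh_lineCoeff]; norm_num [Fin.sum_univ_succ]) la214V_hl_hll_floor
  · exact le_trans (by rw [la214Plane_c3hh_lineCoeff]; norm_num [Fin.sum_univ_succ]) la214V_hl_hlh_floor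
  · exact le_trans (by rw [la214Plane_c3hh_lineCoeff]; norm_num [Fin.sum_univ_succ]) la214V_hl_hhl_floor
  · exact le_trans (by rw [la214Plane_c3hh_lineCoeff]; norm_num [Fin.sum_univ_succ]) la214V_hl_hhh_floor
  · exact le_trans (by rw [la214Plane_c3hh_lineCoeff]; norm_num [Fin.sum_univ_succ]) la214V_hh_lll_floor
  · exact le_trans (by rw [la214Plane_c3hh_lineCoeff]; norm_num [Fin.sum_univ_succ]) la214V_hh_llh_floor
  · exact le_trans (by rw [la214Plane_c3hh_lineCoeff]; norm_num [Fin.sum_univ_succ]) la214V_hh_lhl_floor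
  · exact le_trans (by rw [la214Plane_c3hh_lineCoeff]; norm_num [Fin.sum_univ_succ]) la214V_hh_lhh_floor
  · exact le_trans (by rw [la214Plane_c3hh_lineCoeff]; norm_num [Fin.sum_univ_succ]) la214V_hh_lll_floor
  · exact le_trans (by rw [la214Plane_c3hh_lineCoeff]; norm_num [Fin.sum_univ_succ]) la214V_hh_llh_floor
  · exact le_trans (by rw [la214Plane_c3hh_lineCoeff]; norm_num [Fin.sum_univ_succ]) la214V_hh_lhl_floor
  · exact le_trans (by rw [la214Plane_c3hh_lineCoeff]; norm_num [Fin.sum_univ_succ]) la214V_hh_lhh_floor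
  · exact le_trans (by rw [la214Plane_c3hh_lineCoeff]; norm_num [Fin.sum_univ_succ]) la214V_hh_hll_floor
  · exact le_trans (by rw [la214Plane_c3hh_lineCoeff]; norm_num [Fin.sum_univ_succ]) la214V_hh_hlh_floor
  · exact le_trans (by rw [la214Plane_c3hh_lineCoeff]; norm_num [Fin.sum_univ_succ]) la214V_hh_hhl_floor
  · exact le_trans (by rw [la214Plane_c3hh_lineCoeff]; norm_num [Fin.sum_univ_succ]) la214V_hh_hhh_floor
  · exact le_trans (by rw [la214Plane_c3hh_lineCoeff]; norm_num [Fin.sum_univ_succ]) la214V_hh_hll_floor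
  · exact le_trans (by rw [la214Plane_c3hh_lineCoeff]; norm_num [Fin.sum_univ_succ]) la214V_hh_hlh_floor
  · exact le_trans (by rw [la214Plane_c3hh_lineCoeff]; norm_num [Fin.sum_univ_succ]) la214V_hh_hhl_floor
  · exact le_trans (by rw [la214Plane_c3hh_lineCoeff]; norm_num [Fin.sum_univ_succ]) la214V_hh_hhh_floor

/-- **THE AFFINE BAND OF PLANE `La214_c3hh` ON THE WHOLE COMPANION `emeryBoxLa214v123`**: with `q(p) = (t_pd, t_pp, Δ, 0, U_d, U_p)` and
`A(q) = Σ_k q_k · lineCoeff_k` (coefficients `la214Plane_c3hh_lineCoeff`), `A(q(p)) − 0.5927534 ≤ e ≤ A(q(p))` at EVERY parameter vector `p` of the box — a two-sided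
window that moves with the parameters, of constant width 0.5928 eV per lattice site. Hypothesis-free. [cite: Rockafellar1970, Thm 32.2] [cite: Ruelle1969, §3.3] -/
theorem emeryBoxLa214v123_cuprate_energyBand_c3hh :
    HoldsOn (fun p : EmeryCoord → ℝ =>
      ∑ k, emeryLineCoords 0 p k * lineCoeff cuprateSigns (fun a => (kry_La214_c3hh_s10x10_S a : ℝ) / 1099509064370 / 16) k - (2963767/5000000 : ℝ) ≤
          emeryEnergyDensity (emeryLine cuprateSigns (emeryLineCoords 0 p)) (5 / 4) ∧
        emeryEnergyDensity (emeryLine cuprateSigns (emeryLineCoords 0 p)) (5 / 4) ≤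
          ∑ k, emeryLineCoords 0 p k * lineCoeff cuprateSigns (fun a => (kry_La214_c3hh_s10x10_S a : ℝ) / 1099509064370 / 16) k) emeryBoxLa214v123 :=
  emeryBoxLa214v123_energyWord
    (W := fun q : Fin 6 → ℝ => ∑ k, q k * lineCoeff cuprateSigns (fun a => (kry_La214_c3hh_s10x10_S a : ℝ) / 1099509064370 / 16) k - (2963767/5000000 : ℝ) ≤ emeryEnergyDensity (emeryLine cuprateSigns q) (5 / 4) ∧
      emeryEnergyDensity (emeryLine cuprateSigns q) (5 / 4) ≤ ∑ k, q k * lineCoeff cuprateSigns (fun a => (kry_La214_c3hh_s10x10_S a : ℝ) / 1099509064370 / 16) k)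
    (fun _ hq => la214Band_c3hh_line hq)

/-- **Affine band of plane `La214_cm` as an S2 statement on the delivered six-box** (usable at any explicit point `q` of the box): width `6108557/10000000` ≈ 0.6108557
eV/site, the worst vertex slack (vertex `hh_llh`). [cite: Rockafellar1970, Thm 32.2] [cite: Ruelle1969, §3.3] -/
theorem la214Band_cm_line {q : Fin 6 → ℝ}
    (hq : q ∈ Set.Icc (![129/100, 23/50, 17/10, 0, 483/100, 339/100] : Fin 6 → ℝ) ![38/25, 33/50, 4, 0, 21/2, 613/100]) :
    ∑ k, q k * lineCoeff cuprateSigns (fun a => (kry_La214_cm_s10x10_S a : ℝ) / 1099512466098 / 16) k - (6108557/10000000 : ℝ) ≤ emeryEnergyDensity (emeryLine cuprateSigns q) (5 / 4) ∧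
      emeryEnergyDensity (emeryLine cuprateSigns q) (5 / 4) ≤ ∑ k, q k * lineCoeff cuprateSigns (fun a => (kry_La214_cm_s10x10_S a : ℝ) / 1099512466098 / 16) k := by
  refine emeryEnergyDensity_line_mem_affineBand_of_corners cuprateSigns la214Plane_cm_capTheta _ _ ?_ hq
  intro a ha b hb c hc d hd e he f hf
  simp only [Finset.mem_insert, Finset.mem_singleton, Matrix.cons_val_zero, Matrix.cons_val_one, Matrix.cons_val_two,
    Matrix.cons_val, Matrix.head_cons, Matrix.tail_cons] at ha hb hc hd he hf
  rcases ha with rfl | rfl <;> rcases hb with rfl | rfl <;> rcases hc with rfl | rfl <;> rcases hd with rfl | rfl <;>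
    rcases he with rfl | rfl <;> rcases hf with rfl | rfl
  · exact le_trans (by rw [la214Plane_cm_lineCoeff]; norm_num [Fin.sum_univ_succ]) la214V_ll_lll_floor
  · exact le_trans (by rw [la214Plane_cm_lineCoeff]; norm_num [Fin.sum_univ_succ]) la214V_ll_llh_floor
  · exact le_trans (by rw [la214Plane_cm_lineCoeff]; norm_num [Fin.sum_univ_succ]) la214V_ll_lhl_floor
  · exact le_trans (by rw [la214Plane_cm_lineCoeff]; norm_num [Fin.sum_univ_succ]) la214V_ll_lhh_floor
  · exact le_trans (by rw [la214Plane_cm_lineCoeff]; norm_num [Fin.sum_univ_succ]) la214V_ll_lll_floor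
  · exact le_trans (by rw [la214Plane_cm_lineCoeff]; norm_num [Fin.sum_univ_succ]) la214V_ll_llh_floor
  · exact le_trans (by rw [la214Plane_cm_lineCoeff]; norm_num [Fin.sum_univ_succ]) la214V_ll_lhl_floor
  · exact le_trans (by rw [la214Plane_cm_lineCoeff]; norm_num [Fin.sum_univ_succ]) la214V_ll_lhh_floor
  · exact le_trans (by rw [la214Plane_cm_lineCoeff]; norm_num [Fin.sum_univ_succ]) la214V_ll_hll_floor
  · exact le_trans (by rw [la214Plane_cm_lineCoeff]; norm_num [Fin.sum_univ_succ]) la214V_ll_hlh_floor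
  · exact le_trans (by rw [la214Plane_cm_lineCoeff]; norm_num [Fin.sum_univ_succ]) la214V_ll_hhl_floor
  · exact le_trans (by rw [la214Plane_cm_lineCoeff]; norm_num [Fin.sum_univ_succ]) la214V_ll_hhh_floor
  · exact le_trans (by rw [la214Plane_cm_lineCoeff]; norm_num [Fin.sum_univ_succ]) la214V_ll_hll_floor
  · exact le_trans (by rw [la214Plane_cm_lineCoeff]; norm_num [Fin.sum_univ_succ]) la214V_ll_hlh_floor
  · exact le_trans (by rw [la214Plane_cm_lineCoeff]; norm_num [Fin.sum_univ_succ]) la214V_ll_hhl_floor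
  · exact le_trans (by rw [la214Plane_cm_lineCoeff]; norm_num [Fin.sum_univ_succ]) la214V_ll_hhh_floor
  · exact le_trans (by rw [la214Plane_cm_lineCoeff]; norm_num [Fin.sum_univ_succ]) la214V_lh_lll_floor
  · exact le_trans (by rw [la214Plane_cm_lineCoeff]; norm_num [Fin.sum_univ_succ]) la214V_lh_llh_floor
  · exact le_trans (by rw [la214Plane_cm_lineCoeff]; norm_num [Fin.sum_univ_succ]) la214V_lh_lhl_floor
  · exact le_trans (by rw [la214Plane_cm_lineCoeff]; norm_num [Fin.sum_univ_succ]) la214V_lh_lhh_floor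
  · exact le_trans (by rw [la214Plane_cm_lineCoeff]; norm_num [Fin.sum_univ_succ]) la214V_lh_lll_floor
  · exact le_trans (by rw [la214Plane_cm_lineCoeff]; norm_num [Fin.sum_univ_succ]) la214V_lh_llh_floor
  · exact le_trans (by rw [la214Plane_cm_lineCoeff]; norm_num [Fin.sum_univ_succ]) la214V_lh_lhl_floor
  · exact le_trans (by rw [la214Plane_cm_lineCoeff]; norm_num [Fin.sum_univ_succ]) la214V_lh_lhh_floor
  · exact le_trans (by rw [la214Plane_cm_lineCoeff]; norm_num [Fin.sum_univ_succ]) la214V_lh_hll_floor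
  · exact le_trans (by rw [la214Plane_cm_lineCoeff]; norm_num [Fin.sum_univ_succ]) la214V_lh_hlh_floor
  · exact le_trans (by rw [la214Plane_cm_lineCoeff]; norm_num [Fin.sum_univ_succ]) la214V_lh_hhl_floor
  · exact le_trans (by rw [la214Plane_cm_lineCoeff]; norm_num [Fin.sum_univ_succ]) la214V_lh_hhh_floor
  · exact le_trans (by rw [la214Plane_cm_lineCoeff]; norm_num [Fin.sum_univ_succ]) la214V_lh_hll_floor
  · exact le_trans (by rw [la214Plane_cm_lineCoeff]; norm_num [Fin.sum_univ_succ]) la214V_lh_hlh_floor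
  · exact le_trans (by rw [la214Plane_cm_lineCoeff]; norm_num [Fin.sum_univ_succ]) la214V_lh_hhl_floor
  · exact le_trans (by rw [la214Plane_cm_lineCoeff]; norm_num [Fin.sum_univ_succ]) la214V_lh_hhh_floor
  · exact le_trans (by rw [la214Plane_cm_lineCoeff]; norm_num [Fin.sum_univ_succ]) la214V_hl_lll_floor
  · exact le_trans (by rw [la214Plane_cm_lineCoeff]; norm_num [Fin.sum_univ_succ]) la214V_hl_llh_floor
  · exact le_trans (by rw [la214Plane_cm_lineCoeff]; norm_num [Fin.sum_univ_succ]) la214V_hl_lhl_floor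
  · exact le_trans (by rw [la214Plane_cm_lineCoeff]; norm_num [Fin.sum_univ_succ]) la214V_hl_lhh_floor
  · exact le_trans (by rw [la214Plane_cm_lineCoeff]; norm_num [Fin.sum_univ_succ]) la214V_hl_lll_floor
  · exact le_trans (by rw [la214Plane_cm_lineCoeff]; norm_num [Fin.sum_univ_succ]) la214V_hl_llh_floor
  · exact le_trans (by rw [la214Plane_cm_lineCoeff]; norm_num [Fin.sum_univ_succ]) la214V_hl_lhl_floor
  · exact le_trans (by rw [la214Plane_cm_lineCoeff]; norm_num [Fin.sum_univ_succ]) la214V_hl_lhh_floor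
  · exact le_trans (by rw [la214Plane_cm_lineCoeff]; norm_num [Fin.sum_univ_succ]) la214V_hl_hll_floor
  · exact le_trans (by rw [la214Plane_cm_lineCoeff]; norm_num [Fin.sum_univ_succ]) la214V_hl_hlh_floor
  · exact le_trans (by rw [la214Plane_cm_lineCoeff]; norm_num [Fin.sum_univ_succ]) la214V_hl_hhl_floor
  · exact le_trans (by rw [la214Plane_cm_lineCoeff]; norm_num [Fin.sum_univ_succ]) la214V_hl_hhh_floor
  · exact le_trans (by rw [la214Plane_cm_lineCoeff]; norm_num [Fin.sum_univ_succ]) la214V_hl_hll_floor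
  · exact le_trans (by rw [la214Plane_cm_lineCoeff]; norm_num [Fin.sum_univ_succ]) la214V_hl_hlh_floor
  · exact le_trans (by rw [la214Plane_cm_lineCoeff]; norm_num [Fin.sum_univ_succ]) la214V_hl_hhl_floor
  · exact le_trans (by rw [la214Plane_cm_lineCoeff]; norm_num [Fin.sum_univ_succ]) la214V_hl_hhh_floor
  · exact le_trans (by rw [la214Plane_cm_lineCoeff]; norm_num [Fin.sum_univ_succ]) la214V_hh_lll_floor
  · exact le_trans (by rw [la214Plane_cm_lineCoeff]; norm_num [Fin.sum_univ_succ]) la214V_hh_llh_floor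
  · exact le_trans (by rw [la214Plane_cm_lineCoeff]; norm_num [Fin.sum_univ_succ]) la214V_hh_lhl_floor
  · exact le_trans (by rw [la214Plane_cm_lineCoeff]; norm_num [Fin.sum_univ_succ]) la214V_hh_lhh_floor
  · exact le_trans (by rw [la214Plane_cm_lineCoeff]; norm_num [Fin.sum_univ_succ]) la214V_hh_lll_floor
  · exact le_trans (by rw [la214Plane_cm_lineCoeff]; norm_num [Fin.sum_univ_succ]) la214V_hh_llh_floor
  · exact le_trans (by rw [la214Plane_cm_lineCoeff]; norm_num [Fin.sum_univ_succ]) la214V_hh_lhl_floor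
  · exact le_trans (by rw [la214Plane_cm_lineCoeff]; norm_num [Fin.sum_univ_succ]) la214V_hh_lhh_floor
  · exact le_trans (by rw [la214Plane_cm_lineCoeff]; norm_num [Fin.sum_univ_succ]) la214V_hh_hll_floor
  · exact le_trans (by rw [la214Plane_cm_lineCoeff]; norm_num [Fin.sum_univ_succ]) la214V_hh_hlh_floor
  · exact le_trans (by rw [la214Plane_cm_lineCoeff]; norm_num [Fin.sum_univ_succ]) la214V_hh_hhl_floor
  · exact le_trans (by rw [la214Plane_cm_lineCoeff]; norm_num [Fin.sum_univ_succ]) la214V_hh_hhh_floor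
  · exact le_trans (by rw [la214Plane_cm_lineCoeff]; norm_num [Fin.sum_univ_succ]) la214V_hh_hll_floor
  · exact le_trans (by rw [la214Plane_cm_lineCoeff]; norm_num [Fin.sum_univ_succ]) la214V_hh_hlh_floor
  · exact le_trans (by rw [la214Plane_cm_lineCoeff]; norm_num [Fin.sum_univ_succ]) la214V_hh_hhl_floor
  · exact le_trans (by rw [la214Plane_cm_lineCoeff]; norm_num [Fin.sum_univ_succ]) la214V_hh_hhh_floor

/-- **THE AFFINE BAND OF PLANE `La214_cm` ON THE WHOLE COMPANION `emeryBoxLa214v123`**: with `q(p) = (t_pd, t_pp, Δ, 0, U_d, U_p)` and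
`A(q) = Σ_k q_k · lineCoeff_k` (coefficients `la214Plane_cm_lineCoeff`), `A(q(p)) − 0.6108557 ≤ e ≤ A(q(p))` at EVERY parameter vector `p` of the box — a two-sided
window that moves with the parameters, of constant width 0.6109 eV per lattice site. Hypothesis-free. [cite: Rockafellar1970, Thm 32.2] [cite: Ruelle1969, §3.3] -/
theorem emeryBoxLa214v123_cuprate_energyBand_cm :
    HoldsOn (fun p : EmeryCoord → ℝ =>
      ∑ k, emeryLineCoords 0 p k * lineCoeff cuprateSigns (fun a => (kry_La214_cm_s10x10_S a : ℝ) / 1099512466098 / 16) k - (6108557/10000000 : ℝ) ≤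
          emeryEnergyDensity (emeryLine cuprateSigns (emeryLineCoords 0 p)) (5 / 4) ∧
        emeryEnergyDensity (emeryLine cuprateSigns (emeryLineCoords 0 p)) (5 / 4) ≤
          ∑ k, emeryLineCoords 0 p k * lineCoeff cuprateSigns (fun a => (kry_La214_cm_s10x10_S a : ℝ) / 1099512466098 / 16) k) emeryBoxLa214v123 :=
  emeryBoxLa214v123_energyWord
    (W := fun q : Fin 6 → ℝ => ∑ k, q k * lineCoeff cuprateSigns (fun a => (kry_La214_cm_s10x10_S a : ℝ) / 1099512466098 / 16) k - (6108557/10000000 : ℝ) ≤ emeryEnergyDensity (emeryLine cuprateSigns q) (5 / 4) ∧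
      emeryEnergyDensity (emeryLine cuprateSigns q) (5 / 4) ≤ ∑ k, q k * lineCoeff cuprateSigns (fun a => (kry_La214_cm_s10x10_S a : ℝ) / 1099512466098 / 16) k)
    (fun _ hq => la214Band_cm_line hq)

/-! ## §2 A point with no certificate: the box centre -/

/-- The box centre in line coordinates. [folklore] -/
theorem la214BoxCentre_mem :
    ((![281/200, 14/25, 57/20, 0, 1533/200, 119/25] : Fin 6 → ℝ)) ∈ Set.Icc (![129/100, 23/50, 17/10, 0, 483/100, 339/100] : Fin 6 → ℝ) ![38/25, 33/50, 4, 0, 21/2, 613/100] := by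
  rw [Set.mem_Icc, Pi.le_def, Pi.le_def]
  refine ⟨fun k => ?_, fun k => ?_⟩ <;> fin_cases k <;> simp <;> norm_num

/-- **THE WINDOW AT THE BOX CENTRE** `(t_pd, t_pp, ε_d, ε_p, U_d, U_p) = (281/200, 14/25, 57/20, 0, 1533/200, 119/25)` — a point where NO certificate was computed:
`2.3183345 ≤ e ≤ 2.8297024` eV/site (width 0.5114; floor from the band of plane `La214_c3hh`, cap from plane `La214T_tlhh`). [cite: Rockafellar1970, Thm 32.2] [cite: Ruelle1969, §3.3] -/
theorem la214BoxCentre_energyWindow :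
    (4636669/2000000 : ℝ) ≤ emeryEnergyDensity (emeryLine cuprateSigns (![281/200, 14/25, 57/20, 0, 1533/200, 119/25] : Fin 6 → ℝ)) (5 / 4) ∧
      emeryEnergyDensity (emeryLine cuprateSigns (![281/200, 14/25, 57/20, 0, 1533/200, 119/25] : Fin 6 → ℝ)) (5 / 4) ≤ (442141/156250 : ℝ) := by
  refine ⟨?_, (la214Plane_Ttlhh_cap _).trans (by rw [la214Plane_Ttlhh_lineCoeff]; norm_num [Fin.sum_univ_succ])⟩
  have h := (la214Band_c3hh_line la214BoxCentre_mem).1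
  exact le_trans (by rw [la214Plane_c3hh_lineCoeff]; norm_num [Fin.sum_univ_succ]) h

end Summit.Ventures.CertifiedManyBodySolver.Downfold

end
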